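import Literature.MathematicalPhysics.QuantumFieldTheory.Balaban1983to89.B9Eq353FormDefectTowerDiagonal
import Literature.MathematicalPhysics.QuantumFieldTheory.Balaban1983to89.B9Eq3153FrakGLipschitzEnergy

/-!
# `Balaban1983to89.B9Eq3153FrakGkLipschitzEnergyDiagonal` — T. Bałaban, *Propagators for lattice gauge theories in a background field*, Commun. Math. Phys.
# **99** (1985) 389–434 [Balaban1985BackgroundPropagators] (3.153) p. 426 *«𝔊 = G₁ − G₁Q*(QG₁Q*)⁻¹QG₁ − G₁DRD*G₁»* with Thm 3.13 p. 426 and Thm 3.4 p. 400 AT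
# `k = n+1` AVERAGING LEVELS ON PRINT's DIAGONAL `ηL^{n+1} = 1`: **`𝔊_k(U) − 𝔊_k(1) = O(α)` IN THE FLAT ENERGY NORM — `∃ α₀ C` BEFORE EVERY LATTICE ∕ HEIGHT ∕
# WEIGHT ∕ VOLUME ∕ BACKGROUND BINDER, MODULO THE `R`-LETTER `C_R` AND THE TWO `(Q_kG_kQ_k†)⁻¹`-LETTERS `C_{K,1}`, `C_{K,U}`** (the owner's
# `B9Eq353FormDefectTowerDiagonal` ∕ `B9Eq3153FrakGkBoundDiagonal` energy data + `B9Eq3153FrakGLipschitzEnergy`)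

statement-level skeleton of published theorems with citation tags; proofs where landed; nothing here is a claim about the Yang–Mills mass gap

CITATION HEADER (lean-in-tree rule).  Audit cell `pub-balaban`, sub-cell `t4`, BINDER row NE9; filed by the row OWNER lineage `b2b-balaban-t4-ne9-p1`
(gen 86), the eighth file of the programme «THE 𝔊-STOREY IN THE ENERGY CURRENCY».  Sources READ first-hand in the held text layer
[Balaban1985BackgroundPropagators] (`paper:balaban1985-cmp99-background-propagators`, journal page = PDF page + 388) p. 426 ((3.153), Thm 3.13), p. 400
(Thm 3.4), p. 405 ((3.70)–(3.73)), p. 416 (Thm 3.11); [Balaban1985Variational] (45) p. 285, (110)–(111) p. 294.  THE PRINT (verbatim, p. 426): *«𝔊 = G₁ −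
G₁Q*(QG₁Q*)⁻¹QG₁ − G₁DRD*G₁ … Theorems 3.3, 3.11 hold for 𝔊»*; p. 400 Thm 3.4: *«small perturbations of the operators depending on U only»*.

WHY THIS FILE.  The chart of `cur U` (`Support/NE9CurChartLipschitzAtFlat`) reads the minimiser and the third Green's letter LIPSCHITZ IN THE BACKGROUND AT THE
FLAT POINT; the chain's operator-currency letters carry `‖Δ_a‖ ∝ |η|⁻²`, `‖D‖ ∝ |η|⁻¹`.  Here the abstract `B9Eq3153FrakGLipschitzEnergy.norm_apply_frakG_sub_le`
is instantiated at PRINT's tower operators on the diagonal: structure `1 := U`, structure `0 :=` the flat background; the coercivities `γ₁` and the form defect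
`Θ̄α` of `B9Eq353FormDefectTowerDiagonal`, the `RD*` letter `c_R = 2` of `B9Eq3153FrakGkBoundDiagonal` (at `U` and at `1`), the averaging letters `C_Qα`
(`norm_QkW_sub_flat_le_L2_geometric`) and `M_φ′M_φ` (`norm_QkW_one_le_canonical`), the derivative ∕ divergence remainders `s_Sα`
(`B9Eq373DerivativeRemainderL2`), the `R`-letter `C_Rα` (HYPOTHESIS, as in `B9Eq353FormDefectTowerDiagonal`), `‖R_k‖ ≤ 1`, and the two `K⁻¹`-letters
(HYPOTHESES, ne9-leaf-02's `B9Eq3126KFloor*` slots).  Every letter level- and volume-free on the diagonal; the constant `C` is closed in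
`(d, a, L, M_φ, M_φ′, r, C_τ, ρ_w, C_R, C_{K,1}, C_{K,U})`.

WHAT IS PROVED (sorry-free; 0 `def`; [folklore] composition BY NAME; nothing of [B9] asserted as printed).
* **`exists_norm_frakGk_sub_flat_le_diagonal_closed`** — `∃ α₀ C > 0` BEFORE the binders of `B9Thm311LaplaceAkPositiveDiagonal` + `hR`, then for ANY positivity
  witnesses `hposU`, `hpos1`, ANY onto-witnesses `hQU`, `hQ1`, the two `K⁻¹`-letters and every `x`:
  `‖𝔊_k(U)x − 𝔊_k(1)x‖, ‖curl₁(…)‖, ‖div₁(…)‖ ≤ Cα‖x‖` with `𝔊_k(U) = frakGLatticeK hposU hQU` and the flat `𝔊_k(1) = frakGLatticeK (c := η⁻¹) (R S := 1)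
  (Δ₁ := hessOp 1) (Rr := R_k(1)) (Q := Q_k(1)) hpos1 hQ1` (implicit letters written out, as in `B9Eq3126H1kLipschitzEnergyDiagonal`).
HONEST SCOPE.  FIRST order at the flat point on the diagonal ONLY; the `L²`∕energy clause — no kernel bound, no decay, NOT the (N)-reading; the small-field WINDOWS,
`hRS`, `C_τ`, `ρ_w`, `C_R`, `C_{K,1}`, `C_{K,U}`, the positivity and onto witnesses stay HYPOTHESES; crude constants.  NOT summit progress (cell pub-balaban: NE9 NOT
PRINTED ∕ NOT PROVED; «NE9 ⇐ the named binders»; row WALLED ON A MODEL (O-NE9-1; #5 UNRULED); spine PROVED 0∕9; rung (B)+1 finite T⁴ — NOT infinite volume, NOT mass gap,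
NOT BetaPertH, NOT Clay).  HONEST DEPENDENCY (cell line): continuum YM on T⁴ ⇐ BetaPertH ∧ nine spine estimates (0/9 proved); BetaPertH ⇐ (D1) ∧ (D4) ∧ CAP+tail;
G-an2-4 gates asym, D1 and NE2/3/4.  NEW file; nothing modified.  Net new unproved facts: 0.
-/

noncomputable section

open scoped InnerProductSpace ComplexConjugate BigOperators

namespace Literature.MathematicalPhysics.QuantumFieldTheory.Balaban1983to89.B9Eq3153FrakGkLipschitzEnergyDiagonal

open B4Sect5Torus (TSite)
open B9SectCLatticeCarrier (Bond)
open B11Eq103H1Complex (SiteL2K BondL2K covDerivL2K covDivL2K laplaceALatticeK laplaceAK frakGLatticeK KinvLatticeK KinvK adjoint_injective_of_surjective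
  adjoint_covDerivL2K projR_projR)
open B9Eq310HessianOperator (adTransportW hessOp covCurlL2K)
open B9Eq310DeltaPrime (plaqHolU plaqHolU_one)
open B9Eq315QTorus (perCfg cornerSite)
open B9Eq315QTower (towerP UlevOf)
open B9Eq315QTowerFlat (perCfg_UlevOf_one_mem_U1 norm_Wcx_UlevOf_one_sub_one_le UlevOf_one)
open B9Eq326OperatorTower (laplaceAk QkW RofUk RofUk_isSymmetric)
open B7Prop1Explicit (U1 Wcx boxVec)
open B9Eq373DerivativeRemainderL2 (norm_covDerivL2K_sub_le norm_covDivL2K_sub_le)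
open B9Eq368ProjectionRemainder (norm_projR_le)
open B9Eq384RemainderLetters (norm_adTransportW_sub_le)
open B9Eq315QTowerLipschitzL2 (norm_QkW_sub_flat_le_L2_geometric)
open B9Eq315QTowerFlatNorm (norm_QkW_one_le_canonical)
open B5Eq172HodgePositivity (adTransportW_one adTransportW_inv_one hRS_one)
open B9Eq3153FrakGkBoundDiagonal (exists_energy_letters_diagonal_closed)
open B9Eq353FormDefectTowerDiagonal (exists_energy_pair_diagonal_closed)
open B9Eq3153FrakGLipschitzEnergy (norm_apply_frakG_sub_le)

/-! ## §1 Arithmetic -/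

/-- `e^y − 1 ≤ 2y` for `0 ≤ y ≤ 1`. [folklore] -/
private theorem exp_sub_one_le_two_mul {y : ℝ} (hy0 : 0 ≤ y) (hy1 : y ≤ 1) : Real.exp y - 1 ≤ 2 * y := by
  have h := Real.abs_exp_sub_one_le (x := y) (by rw [abs_of_nonneg hy0]; exact hy1)
  rw [abs_of_nonneg hy0] at h
  exact (le_abs_self _).trans h

/-- On the diagonal `c₀(L^{n+1})^d = c₁` the weighted-reading prefactor is `1`. [cite: Balaban1985BackgroundPropagators, (3.16) p.393] -/
private theorem sqrt_ratio_diagonal {d L n : ℕ} {c₀ c₁ : ℝ} (hc₁ : 0 < c₁) (hw : c₀ * ((L : ℝ) ^ (n + 1)) ^ d = c₁) :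
    Real.sqrt (c₁ / (c₀ * ((L : ℝ) ^ (n + 1)) ^ d)) = 1 := by
  rw [hw, div_self hc₁.ne', Real.sqrt_one]

/-- `x ≤ √S` from `0 ≤ x` and `x² ≤ S`. [folklore] -/
private theorem le_sqrt_of_sq_le {x S : ℝ} (hx : 0 ≤ x) (h : x ^ 2 ≤ S) : x ≤ Real.sqrt S := by
  calc x = Real.sqrt (x ^ 2) := (Real.sqrt_sq hx).symm
    _ ≤ Real.sqrt S := Real.sqrt_le_sqrt h

/-! ## §2 `𝔊_k(U) − 𝔊_k(1)` in the flat energy norm on the diagonal -/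

variable {d : ℕ} (L : ℕ) [NeZero L] (hL : 1 ≤ L)
  {𝔸 : Type*} [NormedRing 𝔸] [NormedAlgebra ℂ 𝔸] [CompleteSpace 𝔸] [NormOneClass 𝔸] [StarRing 𝔸] [NormedStarGroup 𝔸] [StarModule ℂ 𝔸]
  {W : Type*} [NormedAddCommGroup W] [InnerProductSpace ℂ W] [FiniteDimensional ℂ W] (φ : W ≃ₗ[ℂ] 𝔸)
  {Mφ Mφ' : ℝ} (hMφ : 0 ≤ Mφ) (hMφ' : 0 ≤ Mφ') (hφ : ∀ w, ‖φ w‖ ≤ Mφ * ‖w‖) (hφ' : ∀ X, ‖φ.symm X‖ ≤ Mφ' * ‖X‖)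
  {a : ℝ} (ha : 0 < a) {r : ℝ} (hr0 : 0 ≤ r) (hr1 : r < 1)
  (τ : 𝔸 →ₗ[ℂ] ℂ) {Cτ : ℝ} (hτ : ∀ X, ‖τ X‖ ≤ Cτ * ‖X‖) (hCτ : 0 ≤ Cτ) {ρw : ℝ} (hρw : 0 ≤ ρw) {CR : ℝ} (hCR : 0 ≤ CR)
  {CK1 CKU : ℝ} (hCK1 : 0 ≤ CK1) (hCKU : 0 ≤ CKU)

include hMφ hMφ' hφ hφ' ha hr0 hr1 hτ hCτ hρw hCR hCK1 hCKU

-- deep definitional unfolding `frakGLatticeK`∕`KinvLatticeK` ↦ `frakGLin (G1K …)`∕`KinvK` (as in `B9Eq3153FrakGkBoundDiagonal`, `B9Eq3126H1kLipschitzEnergyDiagonal`)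
set_option maxRecDepth 8192 in
/-- **`𝔊_k(U) − 𝔊_k(1) = O(α)` IN THE FLAT ENERGY NORM ON THE DIAGONAL, MODULO `C_R`, `C_{K,1}`, `C_{K,U}`**: there are `α₀, C > 0` (closed in
`(d, a, L, M_φ, M_φ′, r, C_τ, ρ_w, C_R, C_{K,1}, C_{K,U})`) such that for every `n`, `η` (`ηL^{n+1} = 1`), `c₀, c₁` (`c₀(L^{n+1})^d = c₁`, `|η|^d∕c₀ ≤ ρ_w`), `m`,
background `U` of E162's data with `hRS`, the windows `‖U(b) − 1‖ ≤ αη`, `‖U(∂p) − 1‖ ≤ αη²`, `‖Ū^j(b) − 1‖ ≤ ε_j ≤ αr^j`, `0 ≤ α ≤ α₀`, the `R`-letter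
`‖R_k(U)s − R_k(1)s‖ ≤ C_Rα‖s‖`, ANY positivity witnesses `hposU`, `hpos1`, ANY onto-witnesses `hQU`, `hQ1`, the two `K⁻¹`-letters and every `x`:
`‖𝔊_k(U)x − 𝔊_k(1)x‖ ≤ Cα‖x‖`, `‖curl₁(𝔊_k(U)x − 𝔊_k(1)x)‖ ≤ Cα‖x‖`, `‖div₁(𝔊_k(U)x − 𝔊_k(1)x)‖ ≤ Cα‖x‖` — `B9Eq3153FrakGLipschitzEnergy.norm_apply_frakG_sub_le`
at the tower's form letters.  No operator bound of `Δ_a`, `Δ_a(U) − Δ_a(1)`, `D`, no `H`-letter, no Neumann series. [cite: Balaban1985BackgroundPropagators,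
(3.153) p.426, Thm 3.13 p.426, Thm 3.4 p.400, (3.70)–(3.73) p.405, Thm 3.11 p.416; Balaban1985Variational, (45) p.285, (110)–(111) p.294] -/
theorem exists_norm_frakGk_sub_flat_le_diagonal_closed :
    ∃ α₀ C : ℝ, 0 < α₀ ∧ 0 < C ∧ ∀ (n : ℕ) (η : ℝ), η * (L : ℝ) ^ (n + 1) = 1 →
      ∀ (c₀ c₁ : ℝ) [Fact (0 < c₀)] [Fact (0 < c₁)], c₀ * ((L : ℝ) ^ (n + 1)) ^ d = c₁ → |η| ^ d / c₀ ≤ ρw →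
      ∀ (m : Fin d → ℕ) [∀ i, NeZero (m i)] (U : Bond d (towerP L m (n + 1)) → 𝔸ˣ) (αU : ℕ → ℝ) (hα1 : ∀ j, αU j ≤ 1 / 64)
        (hU1 : ∀ (j : ℕ) (x : B7Prop1Explicit.Site d) (κ : Fin d), perCfg (towerP L m (j + 1)) (UlevOf L m (n + 1) U j) x κ ∈ U1 𝔸)
        (hreg : ∀ (j : ℕ) (y : TSite d (towerP L m j)) (κ : Fin d) (r : Fin d → Fin L),
          ‖((Wcx L (perCfg (towerP L m (j + 1)) (UlevOf L m (n + 1) U j)) (cornerSite L y) κ (boxVec L r) : 𝔸ˣ) : 𝔸) - 1‖ ≤ αU j)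
        (εU : ℕ → ℝ), (∀ j, 0 ≤ εU j) → (∀ (j : ℕ) (b : Bond d (towerP L m (j + 1))), ‖(UlevOf L m (n + 1) U j b : 𝔸) - 1‖ ≤ εU j) →
      ∀ {α : ℝ}, 0 ≤ α → α ≤ α₀ →
        (∀ (b : Bond d (towerP L m (n + 1))) (v u : W), ⟪adTransportW φ U b v, u⟫_ℂ = ⟪v, adTransportW φ (fun b => (U b)⁻¹) b u⟫_ℂ) →
        (∀ b, U b ∈ U1 𝔸) → (∀ b, ‖(U b : 𝔸) - 1‖ ≤ α * η) →
        (∀ p : B9SectCLatticeCarrier.Plaq d (towerP L m (n + 1)), ‖(plaqHolU U p : 𝔸) - 1‖ ≤ α * η ^ 2) →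
        (∀ j < n + 1, εU j ≤ α * r ^ j) →
        (∀ s : SiteL2K ℂ d (towerP L m (n + 1)) c₀ W,
          ‖RofUk L m n φ η U s - RofUk L m n φ η (fun _ : Bond d (towerP L m (n + 1)) => (1 : 𝔸ˣ)) s‖ ≤ CR * α * ‖s‖) →
        ∀ (hposU : ∀ x : BondL2K ℂ d (towerP L m (n + 1)) c₀ W, x ≠ 0 →
            0 < RCLike.re ⟪x, laplaceAk L m n φ η U hL αU hα1 hU1 hreg τ (c₀ := c₀) (c₁ := c₁) a x⟫_ℂ)
          (hpos1 : ∀ x : BondL2K ℂ d (towerP L m (n + 1)) c₀ W, x ≠ 0 →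
            0 < RCLike.re ⟪x, laplaceAk L m n φ η (fun _ : Bond d (towerP L m (n + 1)) => (1 : 𝔸ˣ)) hL (fun _ => 0) (fun _ => by norm_num)
              (perCfg_UlevOf_one_mem_U1 L m (n + 1)) (norm_Wcx_UlevOf_one_sub_one_le L m (n + 1) (fun _ => 0) (fun _ => le_rfl)) τ
              (c₀ := c₀) (c₁ := c₁) a x⟫_ℂ)
          (hQU : Function.Surjective (QkW L m n φ U hL αU hα1 hU1 hreg (c₀ := c₀) (c₁ := c₁)))
          (hQ1 : Function.Surjective (QkW L m n φ (fun _ : Bond d (towerP L m (n + 1)) => (1 : 𝔸ˣ)) hL (fun _ => 0) (fun _ => by norm_num)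
            (perCfg_UlevOf_one_mem_U1 L m (n + 1)) (norm_Wcx_UlevOf_one_sub_one_le L m (n + 1) (fun _ => 0) (fun _ => le_rfl)) (c₀ := c₀) (c₁ := c₁))),
        (∀ b : BondL2K ℂ d m c₁ W, ‖KinvLatticeK (c := ((η : ℂ))⁻¹) (R := adTransportW φ (fun _ : Bond d (towerP L m (n + 1)) => (1 : 𝔸ˣ)))
              (S := adTransportW φ fun _ : Bond d (towerP L m (n + 1)) => (1 : 𝔸ˣ)⁻¹) (Δ₁ := hessOp φ η (fun _ : Bond d (towerP L m (n + 1)) => (1 : 𝔸ˣ)) τ)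
              (Rr := RofUk L m n φ η (fun _ : Bond d (towerP L m (n + 1)) => (1 : 𝔸ˣ)))
              (Q := (QkW L m n φ (fun _ : Bond d (towerP L m (n + 1)) => (1 : 𝔸ˣ)) hL (fun _ => 0) (fun _ => by norm_num)
            (perCfg_UlevOf_one_mem_U1 L m (n + 1)) (norm_Wcx_UlevOf_one_sub_one_le L m (n + 1) (fun _ => 0) (fun _ => le_rfl)) (c₀ := c₀) (c₁ := c₁))) (a := a) hpos1 hQ1 b‖ ≤ CK1 * ‖b‖) →
        (∀ c : BondL2K ℂ d m c₁ W, ‖KinvLatticeK hposU hQU c‖ ≤ CKU * ‖c‖) →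
        ∀ x : BondL2K ℂ d (towerP L m (n + 1)) c₀ W,
          ‖frakGLatticeK hposU hQU x - frakGLatticeK (c := ((η : ℂ))⁻¹) (R := adTransportW φ (fun _ : Bond d (towerP L m (n + 1)) => (1 : 𝔸ˣ)))
              (S := adTransportW φ fun _ : Bond d (towerP L m (n + 1)) => (1 : 𝔸ˣ)⁻¹) (Δ₁ := hessOp φ η (fun _ : Bond d (towerP L m (n + 1)) => (1 : 𝔸ˣ)) τ)
              (Rr := RofUk L m n φ η (fun _ : Bond d (towerP L m (n + 1)) => (1 : 𝔸ˣ)))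
              (Q := (QkW L m n φ (fun _ : Bond d (towerP L m (n + 1)) => (1 : 𝔸ˣ)) hL (fun _ => 0) (fun _ => by norm_num)
            (perCfg_UlevOf_one_mem_U1 L m (n + 1)) (norm_Wcx_UlevOf_one_sub_one_le L m (n + 1) (fun _ => 0) (fun _ => le_rfl)) (c₀ := c₀) (c₁ := c₁))) (a := a) hpos1 hQ1 x‖ ≤ C * α * ‖x‖ ∧
          ‖covCurlL2K ℂ c₀ ((η : ℂ))⁻¹ (adTransportW φ (fun _ : Bond d (towerP L m (n + 1)) => (1 : 𝔸ˣ)))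
            (frakGLatticeK hposU hQU x - frakGLatticeK (c := ((η : ℂ))⁻¹) (R := adTransportW φ (fun _ : Bond d (towerP L m (n + 1)) => (1 : 𝔸ˣ)))
              (S := adTransportW φ fun _ : Bond d (towerP L m (n + 1)) => (1 : 𝔸ˣ)⁻¹) (Δ₁ := hessOp φ η (fun _ : Bond d (towerP L m (n + 1)) => (1 : 𝔸ˣ)) τ)
              (Rr := RofUk L m n φ η (fun _ : Bond d (towerP L m (n + 1)) => (1 : 𝔸ˣ)))
              (Q := (QkW L m n φ (fun _ : Bond d (towerP L m (n + 1)) => (1 : 𝔸ˣ)) hL (fun _ => 0) (fun _ => by norm_num)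
            (perCfg_UlevOf_one_mem_U1 L m (n + 1)) (norm_Wcx_UlevOf_one_sub_one_le L m (n + 1) (fun _ => 0) (fun _ => le_rfl)) (c₀ := c₀) (c₁ := c₁))) (a := a) hpos1 hQ1 x)‖ ≤ C * α * ‖x‖ ∧
          ‖covDivL2K ℂ c₀ ((η : ℂ))⁻¹ (adTransportW φ fun _ : Bond d (towerP L m (n + 1)) => (1 : 𝔸ˣ)⁻¹)
            (frakGLatticeK hposU hQU x - frakGLatticeK (c := ((η : ℂ))⁻¹) (R := adTransportW φ (fun _ : Bond d (towerP L m (n + 1)) => (1 : 𝔸ˣ)))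
              (S := adTransportW φ fun _ : Bond d (towerP L m (n + 1)) => (1 : 𝔸ˣ)⁻¹) (Δ₁ := hessOp φ η (fun _ : Bond d (towerP L m (n + 1)) => (1 : 𝔸ˣ)) τ)
              (Rr := RofUk L m n φ η (fun _ : Bond d (towerP L m (n + 1)) => (1 : 𝔸ˣ)))
              (Q := (QkW L m n φ (fun _ : Bond d (towerP L m (n + 1)) => (1 : 𝔸ˣ)) hL (fun _ => 0) (fun _ => by norm_num)
            (perCfg_UlevOf_one_mem_U1 L m (n + 1)) (norm_Wcx_UlevOf_one_sub_one_le L m (n + 1) (fun _ => 0) (fun _ => le_rfl)) (c₀ := c₀) (c₁ := c₁))) (a := a) hpos1 hQ1 x)‖ ≤ C * α * ‖x‖ := by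
  obtain ⟨α₁, γ₁, Θb, hα₁, hγ₁, hΘb, H⟩ := exists_energy_pair_diagonal_closed L hL φ hMφ hMφ' hφ hφ' ha hr0 hr1 τ hτ hCτ hρw hCR
  obtain ⟨α₂, γ₂, hα₂, hγ₂, H2⟩ := exists_energy_letters_diagonal_closed L hL φ hMφ hMφ' hφ hφ' ha hr0 hr1 τ hτ hCτ hρw
  have hL0 : (0 : ℝ) < L := by exact_mod_cast Nat.pos_of_ne_zero (NeZero.ne L)
  have h1r : 0 < 1 - r := by linarith
  obtain ⟨sS, hsSdef⟩ : ∃ sS : ℝ, sS = 2 * Real.sqrt d * (Mφ * Mφ') := ⟨_, rfl⟩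
  obtain ⟨Ξ, hΞdef⟩ : ∃ Ξ : ℝ, Ξ = Real.sqrt ((L : ℝ) ^ d) * (Real.sqrt (2 * d) * (102 * (d + 1) ^ 2 * L)) := ⟨_, rfl⟩
  obtain ⟨CQ, hCQdef⟩ : ∃ CQ : ℝ, CQ = 2 * (Mφ' * Mφ) * Ξ / (1 - r) := ⟨_, rfl⟩
  obtain ⟨sP, hsPdef⟩ : ∃ sP : ℝ, sP = sS + CR := ⟨_, rfl⟩
  obtain ⟨MQ0, hMQ0def⟩ : ∃ MQ0 : ℝ, MQ0 = Mφ' * Mφ + CQ := ⟨_, rfl⟩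
  have hsS : 0 ≤ sS := by rw [hsSdef]; positivity
  have hΞ0 : 0 ≤ Ξ := by rw [hΞdef]; positivity
  have hCQ : 0 ≤ CQ := by rw [hCQdef]; positivity
  have hsP : 0 ≤ sP := by rw [hsPdef]; positivity
  have hMM : 0 ≤ Mφ' * Mφ := mul_nonneg hMφ' hMφ
  have hMQ0 : 0 ≤ MQ0 := by rw [hMQ0def]; positivity
  obtain ⟨Cb, hCbdef⟩ : ∃ Cb : ℝ, Cb = ((Θb) / γ₁ * γ₁⁻¹ + ((((Θb) * Real.sqrt (CK1 / γ₁) + (CQ) * CK1) / γ₁ + Real.sqrt (CKU / γ₁) * ((CQ) * Real.sqrt (CK1 / γ₁))) * MQ0 * γ₁⁻¹ + Real.sqrt (CK1 / γ₁) * ((CQ) * γ₁⁻¹ + MQ0 * ((Θb) / γ₁) * γ₁⁻¹)) + (Real.sqrt (γ₁⁻¹ * 2) * ((sP) * γ₁⁻¹ + 1 * ((Θb) / γ₁) * γ₁⁻¹) + (γ₁⁻¹ * (sS) * 1 + Real.sqrt (γ₁⁻¹ * γ₁⁻¹) * (CR) + (Θb) / γ₁ * Real.sqrt (2 / γ₁))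 * 1 * γ₁⁻¹)) := ⟨_, rfl⟩
  have hCb : 0 ≤ Cb := by rw [hCbdef]; positivity
  refine ⟨min α₁ (min α₂ (min 1 ((1 - r) / (Ξ + 1)))), Cb + 1, lt_min hα₁ (lt_min hα₂ (lt_min one_pos (by positivity))), by positivity, ?_⟩
  intro n η hηL c₀ c₁ _ _ hw hρ m _ U αU hα1 hU1 hreg εU hεU hUε α hα0 hαle hRS hUb hUη hpl hεg hR hposU hpos1 hQU hQ1 hK1 hKU x
  -- scalar facts first (thin context)
  have hc₁ : 0 < c₁ := Fact.out
  have hLr : (0 : ℝ) < (L : ℝ) ^ (n + 1) := pow_pos hL0 _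
  have hηL0 : 0 < η * (L : ℝ) ^ (n + 1) := by rw [hηL]; exact one_pos
  have hη0 : 0 < η := pos_of_mul_pos_left hηL0 hLr.le
  have hc : conj ((η : ℂ))⁻¹ = ((η : ℂ))⁻¹ := by rw [map_inv₀, Complex.conj_ofReal]
  have hnη : ‖((η : ℂ))⁻¹‖ * η = 1 := by
    rw [norm_inv, Complex.norm_real, Real.norm_eq_abs, abs_of_pos hη0, inv_mul_cancel₀ hη0.ne']
  have hs : c₁ * (η * (L : ℝ) ^ (n + 1)) ^ 2 = c₀ * ((L : ℝ) ^ (n + 1)) ^ d := by rw [hηL, one_pow, mul_one, hw]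
  have hαα₁ : α ≤ α₁ := hαle.trans (min_le_left _ _)
  have hαα₂ : α ≤ α₂ := hαle.trans ((min_le_right _ _).trans (min_le_left _ _))
  have hαone : α ≤ 1 := hαle.trans ((min_le_right _ _).trans ((min_le_right _ _).trans (min_le_left _ _)))
  have hαΞ : Ξ * (α / (1 - r)) ≤ 1 := by
    have h1 : α ≤ (1 - r) / (Ξ + 1) := hαle.trans ((min_le_right _ _).trans ((min_le_right _ _).trans (min_le_right _ _)))
    rw [← mul_div_assoc, div_le_one h1r]
    calc Ξ * α ≤ Ξ * ((1 - r) / (Ξ + 1)) := mul_le_mul_of_nonneg_left h1 hΞ0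
      _ ≤ 1 - r := by
          rw [mul_div_assoc', div_le_iff₀ (add_pos_of_nonneg_of_pos hΞ0 one_pos)]
          calc Ξ * (1 - r) ≤ Ξ * (1 - r) + (1 - r) := le_add_of_nonneg_right h1r.le
            _ = (1 - r) * (Ξ + 1) := by ring
  have hαη : 0 ≤ α * η := mul_nonneg hα0 hη0.le
  have hεR0 : 0 ≤ 2 * Mφ * Mφ' * (α * η) := mul_nonneg (mul_nonneg (mul_nonneg zero_le_two hMφ) hMφ') hαη
  have hαη2 : 0 ≤ α * η ^ 2 := mul_nonneg hα0 (sq_nonneg η)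
  have hαr : ∀ j : ℕ, 0 ≤ α * r ^ j := fun j => mul_nonneg hα0 (pow_nonneg hr0 j)
  have hsSα : 0 ≤ sS * α := mul_nonneg hsS hα0
  have hsPα : 0 ≤ sP * α := mul_nonneg hsP hα0
  have hCQα : 0 ≤ CQ * α := mul_nonneg hCQ hα0
  have hCRα : 0 ≤ CR * α := mul_nonneg hCR hα0
  have hΘα : 0 ≤ Θb * α := mul_nonneg hΘb.le hα0
  have he : Real.exp (Ξ * (α / (1 - r))) - 1 ≤ 2 * (Ξ * (α / (1 - r))) :=
    exp_sub_one_le_two_mul (mul_nonneg hΞ0 (div_nonneg hα0 h1r.le)) hαΞ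
  have heM : Mφ' * Mφ * (Real.exp (Ξ * (α / (1 - r))) - 1) ≤ CQ * α := by
    have h1 := mul_le_mul_of_nonneg_left he hMM
    have h2 : Mφ' * Mφ * (2 * (Ξ * (α / (1 - r)))) = CQ * α := by rw [hCQdef]; ring
    rw [← h2]; exact h1
  have hsSe : ‖((η : ℂ))⁻¹‖ * (2 * Mφ * Mφ' * (α * η)) * Real.sqrt d = sS * α := by
    rw [hsSdef, show ‖((η : ℂ))⁻¹‖ * (2 * Mφ * Mφ' * (α * η)) = 2 * Mφ * Mφ' * α * (‖((η : ℂ))⁻¹‖ * η) by ring, hnη]; ring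
  have hMQα : Mφ' * Mφ + CQ * α ≤ MQ0 := by
    rw [hMQ0def]; exact add_le_add le_rfl (mul_le_of_le_one_right hCQ hαone)
  have hCfin : ((Θb * α) / γ₁ * γ₁⁻¹ + ((((Θb * α) * Real.sqrt (CK1 / γ₁) + (CQ * α) * CK1) / γ₁ + Real.sqrt (CKU / γ₁) * ((CQ * α) * Real.sqrt (CK1 / γ₁))) * MQ0 * γ₁⁻¹ + Real.sqrt (CK1 / γ₁) * ((CQ * α) * γ₁⁻¹ + MQ0 * ((Θb * α) / γ₁) * γ₁⁻¹)) + (Real.sqrt (γ₁⁻¹ * 2) * ((sP * α) * γ₁⁻¹ + 1 * ((Θb * α) / γ₁) * γ₁⁻¹) + (γ₁⁻¹ * (sS * α) * 1 + Real.sqrt (γ₁⁻¹ * γ₁⁻¹) * (CR * α) + (Θb * α) / γ₁ * Real.sqrt (2 / γ₁)) * 1 * γ₁⁻¹)) = Cb * α := by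
    rw [hCbdef]; ring
  have hCb1 : Cb * α * ‖x‖ ≤ (Cb + 1) * α * ‖x‖ :=
    mul_le_mul_of_nonneg_right (mul_le_mul_of_nonneg_right (le_add_of_nonneg_right zero_le_one) hα0) (norm_nonneg _)
  -- the energy data of the pair (`B9Eq353FormDefectTowerDiagonal`) and the `RD*` letter `c_R = 2` (`B9Eq3153FrakGkBoundDiagonal`) at `U` and at `1`
  obtain ⟨HU, H1, HT⟩ := H n η hηL c₀ c₁ hw hρ m U αU hα1 hU1 hreg εU hεU hUε hα0 hαα₁ hRS hUb hUη hpl hεg hR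
  have H2U := H2 n η hηL c₀ c₁ hw hρ m U αU hα1 hU1 hreg εU hεU hUε hα0 hαα₂ hRS hUb hUη hpl hεg
  have hUε1 : ∀ (j : ℕ) (b : Bond d (towerP L m (j + 1))),
      ‖(UlevOf L m (n + 1) (fun _ : Bond d (towerP L m (n + 1)) => (1 : 𝔸ˣ)) j b : 𝔸) - 1‖ ≤ (fun _ : ℕ => (0 : ℝ)) j := by
    intro j b; rw [UlevOf_one, Units.val_one, sub_self, norm_zero]
  have H21 := H2 n η hηL c₀ c₁ hw hρ m (fun _ : Bond d (towerP L m (n + 1)) => (1 : 𝔸ˣ)) (fun _ => 0) (fun _ => by norm_num)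
    (perCfg_UlevOf_one_mem_U1 L m (n + 1)) (norm_Wcx_UlevOf_one_sub_one_le L m (n + 1) (fun _ => 0) (fun _ => le_rfl)) (fun _ => 0)
    (fun _ => le_rfl) hUε1 hα0 hαα₂ (hRS_one φ) (fun _ => Subgroup.one_mem _)
    (fun _ => by rw [Units.val_one, sub_self, norm_zero]; exact hαη)
    (fun p => by rw [plaqHolU_one, Units.val_one, sub_self, norm_zero]; exact hαη2) (fun j _ => hαr j)
  have hRDU : ∀ y : BondL2K ℂ d (towerP L m (n + 1)) c₀ W, ‖RofUk L m n φ η U (covDivL2K ℂ c₀ ((η : ℂ))⁻¹ (adTransportW φ fun b => (U b)⁻¹) y)‖ ^ 2 ≤ 2 * RCLike.re ⟪y, laplaceAk L m n φ η U hL αU hα1 hU1 hreg τ (c₀ := c₀) (c₁ := c₁) a y⟫_ℂ := fun y => (H2U y).2.1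
  have hRD1 : ∀ y : BondL2K ℂ d (towerP L m (n + 1)) c₀ W, ‖RofUk L m n φ η (fun _ : Bond d (towerP L m (n + 1)) => (1 : 𝔸ˣ)) (covDivL2K ℂ c₀ ((η : ℂ))⁻¹ (adTransportW φ fun _ : Bond d (towerP L m (n + 1)) => (1 : 𝔸ˣ)⁻¹) y)‖ ^ 2 ≤ 2 * RCLike.re ⟪y, laplaceAk L m n φ η (fun _ : Bond d (towerP L m (n + 1)) => (1 : 𝔸ˣ)) hL (fun _ => 0) (fun _ => by norm_num)
              (perCfg_UlevOf_one_mem_U1 L m (n + 1)) (norm_Wcx_UlevOf_one_sub_one_le L m (n + 1) (fun _ => 0) (fun _ => le_rfl)) τ (c₀ := c₀) (c₁ := c₁) a y⟫_ℂ := fun y => (H21 y).2.1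
  -- the flat energy weight `N₁` (opaque)
  obtain ⟨N, hNdef⟩ : ∃ N : BondL2K ℂ d (towerP L m (n + 1)) c₀ W → ℝ, N = fun z =>
      Real.sqrt (‖covCurlL2K ℂ c₀ ((η : ℂ))⁻¹ (adTransportW φ (fun _ : Bond d (towerP L m (n + 1)) => (1 : 𝔸ˣ))) z‖ ^ 2 + ‖covDivL2K ℂ c₀ ((η : ℂ))⁻¹ (adTransportW φ fun _ : Bond d (towerP L m (n + 1)) => (1 : 𝔸ˣ)⁻¹) z‖ ^ 2 + ‖z‖ ^ 2) := ⟨_, rfl⟩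
  have hNz : ∀ z, N z = Real.sqrt (‖covCurlL2K ℂ c₀ ((η : ℂ))⁻¹ (adTransportW φ (fun _ : Bond d (towerP L m (n + 1)) => (1 : 𝔸ˣ))) z‖ ^ 2 + ‖covDivL2K ℂ c₀ ((η : ℂ))⁻¹ (adTransportW φ fun _ : Bond d (towerP L m (n + 1)) => (1 : 𝔸ˣ)⁻¹) z‖ ^ 2 + ‖z‖ ^ 2) := fun z => by rw [hNdef]
  have hN0 : ∀ z, 0 ≤ N z := fun z => by rw [hNz]; exact Real.sqrt_nonneg _
  have hNsq : ∀ z, N z ^ 2 = ‖covCurlL2K ℂ c₀ ((η : ℂ))⁻¹ (adTransportW φ (fun _ : Bond d (towerP L m (n + 1)) => (1 : 𝔸ˣ))) z‖ ^ 2 + ‖covDivL2K ℂ c₀ ((η : ℂ))⁻¹ (adTransportW φ fun _ : Bond d (towerP L m (n + 1)) => (1 : 𝔸ˣ)⁻¹) z‖ ^ 2 + ‖z‖ ^ 2 := fun z => by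
    rw [hNz]; exact Real.sq_sqrt (add_nonneg (add_nonneg (sq_nonneg _) (sq_nonneg _)) (sq_nonneg _))
  have hNn : ∀ z, ‖z‖ ≤ N z := fun z => by
    rw [hNz]; exact le_sqrt_of_sq_le (norm_nonneg _) (le_add_of_nonneg_left (add_nonneg (sq_nonneg _) (sq_nonneg _)))
  have hNc : ∀ z, ‖covCurlL2K ℂ c₀ ((η : ℂ))⁻¹ (adTransportW φ (fun _ : Bond d (towerP L m (n + 1)) => (1 : 𝔸ˣ))) z‖ ≤ N z := fun z => by
    rw [hNz]; exact le_sqrt_of_sq_le (norm_nonneg _) ((le_add_of_nonneg_right (sq_nonneg _)).trans (le_add_of_nonneg_right (sq_nonneg _)))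
  have hNd : ∀ z, ‖covDivL2K ℂ c₀ ((η : ℂ))⁻¹ (adTransportW φ fun _ : Bond d (towerP L m (n + 1)) => (1 : 𝔸ˣ)⁻¹) z‖ ≤ N z := fun z => by
    rw [hNz]; exact le_sqrt_of_sq_le (norm_nonneg _) ((le_add_of_nonneg_left (sq_nonneg _)).trans (le_add_of_nonneg_right (sq_nonneg _)))
  have hNid : ∀ z : BondL2K ℂ d (towerP L m (n + 1)) c₀ W, ‖(LinearMap.id : BondL2K ℂ d (towerP L m (n + 1)) c₀ W →ₗ[ℂ] BondL2K ℂ d (towerP L m (n + 1)) c₀ W) z‖ ≤ N z := fun z => by rw [LinearMap.id_apply]; exact hNn z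
  have hcoerU : ∀ z, γ₁ * N z ^ 2 ≤ RCLike.re ⟪z, laplaceAk L m n φ η U hL αU hα1 hU1 hreg τ (c₀ := c₀) (c₁ := c₁) a z⟫_ℂ := fun z => by rw [hNsq]; exact HU z
  have hcoer1 : ∀ z, γ₁ * N z ^ 2 ≤ RCLike.re ⟪z, laplaceAk L m n φ η (fun _ : Bond d (towerP L m (n + 1)) => (1 : 𝔸ˣ)) hL (fun _ => 0) (fun _ => by norm_num)
              (perCfg_UlevOf_one_mem_U1 L m (n + 1)) (norm_Wcx_UlevOf_one_sub_one_le L m (n + 1) (fun _ => 0) (fun _ => le_rfl)) τ (c₀ := c₀) (c₁ := c₁) a z⟫_ℂ := fun z => by rw [hNsq]; exact H1 z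
  have hT : ∀ u v : BondL2K ℂ d (towerP L m (n + 1)) c₀ W, ‖⟪u, laplaceAk L m n φ η U hL αU hα1 hU1 hreg τ (c₀ := c₀) (c₁ := c₁) a v⟫_ℂ - ⟪u, laplaceAk L m n φ η (fun _ : Bond d (towerP L m (n + 1)) => (1 : 𝔸ˣ)) hL (fun _ => 0) (fun _ => by norm_num)
              (perCfg_UlevOf_one_mem_U1 L m (n + 1)) (norm_Wcx_UlevOf_one_sub_one_le L m (n + 1) (fun _ => 0) (fun _ => le_rfl)) τ (c₀ := c₀) (c₁ := c₁) a v⟫_ℂ‖ ≤ Θb * α * N u * N v :=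
    fun u v => by rw [hNz u, hNz v]; exact HT u v
  -- the first-order transport letters and the remainders δ_D (derivative), δ_S (divergence), δ_P (`RD*`)
  have hRε : ∀ (b : Bond d (towerP L m (n + 1))) (w : W), ‖adTransportW φ U b w - w‖ ≤ (2 * Mφ * Mφ' * (α * η)) * ‖w‖ :=
    fun b w => norm_adTransportW_sub_le φ hφ hφ' hMφ' U b (hUb b) (hUη b) w
  have hR₁ : ∀ (b : Bond d (towerP L m (n + 1))) (w : W), adTransportW φ (fun _ : Bond d (towerP L m (n + 1)) => (1 : 𝔸ˣ)) b w = w :=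
    fun b w => by rw [adTransportW_one]; rfl
  have hS₁ : ∀ (b : Bond d (towerP L m (n + 1))) (w : W), adTransportW φ (fun _ : Bond d (towerP L m (n + 1)) => (1 : 𝔸ˣ)⁻¹) b w = w :=
    fun b w => by rw [adTransportW_inv_one]; rfl
  have hDd : ∀ s : SiteL2K ℂ d (towerP L m (n + 1)) c₀ W, ‖covDerivL2K ℂ c₀ ((η : ℂ))⁻¹ (adTransportW φ U) s - covDerivL2K ℂ c₀ ((η : ℂ))⁻¹ (adTransportW φ (fun _ : Bond d (towerP L m (n + 1)) => (1 : 𝔸ˣ))) s‖ ≤ (sS * α) * ‖s‖ := fun s => by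
    have h := norm_covDerivL2K_sub_le ((η : ℂ))⁻¹ hεR0 hRε hR₁ s
    rw [hsSe] at h; exact h
  have hSv : ∀ w : BondL2K ℂ d (towerP L m (n + 1)) c₀ W, ‖covDivL2K ℂ c₀ ((η : ℂ))⁻¹ (adTransportW φ fun b => (U b)⁻¹) w - covDivL2K ℂ c₀ ((η : ℂ))⁻¹ (adTransportW φ fun _ : Bond d (towerP L m (n + 1)) => (1 : 𝔸ˣ)⁻¹) w‖ ≤ (sS * α) * ‖w‖ := fun w => by
    have h := norm_covDivL2K_sub_le ((η : ℂ))⁻¹ hc hεR0 hRε hR₁ hRS hS₁ w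
    rw [hsSe] at h; exact h
  have hRle : ∀ v : SiteL2K ℂ d (towerP L m (n + 1)) c₀ W, ‖RofUk L m n φ η U v‖ ≤ ‖v‖ := fun v => by
    unfold RofUk B11Eq103H1Complex.RLatticeK; exact norm_projR_le _ _ v
  have hR1le : ∀ v : SiteL2K ℂ d (towerP L m (n + 1)) c₀ W, ‖RofUk L m n φ η (fun _ : Bond d (towerP L m (n + 1)) => (1 : 𝔸ˣ)) v‖ ≤ ‖v‖ := fun v => by
    unfold RofUk B11Eq103H1Complex.RLatticeK; exact norm_projR_le _ _ v
  have hRone : ∀ v : SiteL2K ℂ d (towerP L m (n + 1)) c₀ W, ‖RofUk L m n φ η U v‖ ≤ 1 * ‖v‖ := fun v => by rw [one_mul]; exact hRle v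
  have hP : ∀ w : BondL2K ℂ d (towerP L m (n + 1)) c₀ W, ‖RofUk L m n φ η U (covDivL2K ℂ c₀ ((η : ℂ))⁻¹ (adTransportW φ fun b => (U b)⁻¹) w) - RofUk L m n φ η (fun _ : Bond d (towerP L m (n + 1)) => (1 : 𝔸ˣ)) (covDivL2K ℂ c₀ ((η : ℂ))⁻¹ (adTransportW φ fun _ : Bond d (towerP L m (n + 1)) => (1 : 𝔸ˣ)⁻¹) w)‖ ≤ (sP * α) * N w := by
    intro w
    have h1 : ‖RofUk L m n φ η U (covDivL2K ℂ c₀ ((η : ℂ))⁻¹ (adTransportW φ fun b => (U b)⁻¹) w) - RofUk L m n φ η U (covDivL2K ℂ c₀ ((η : ℂ))⁻¹ (adTransportW φ fun _ : Bond d (towerP L m (n + 1)) => (1 : 𝔸ˣ)⁻¹) w)‖ ≤ (sS * α) * ‖w‖ := by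
      rw [← map_sub]; exact (hRle _).trans (hSv w)
    have h2 := hR (covDivL2K ℂ c₀ ((η : ℂ))⁻¹ (adTransportW φ fun _ : Bond d (towerP L m (n + 1)) => (1 : 𝔸ˣ)⁻¹) w)
    have h3 := norm_sub_le_norm_sub_add_norm_sub (RofUk L m n φ η U (covDivL2K ℂ c₀ ((η : ℂ))⁻¹ (adTransportW φ fun b => (U b)⁻¹) w)) (RofUk L m n φ η U (covDivL2K ℂ c₀ ((η : ℂ))⁻¹ (adTransportW φ fun _ : Bond d (towerP L m (n + 1)) => (1 : 𝔸ˣ)⁻¹) w)) (RofUk L m n φ η (fun _ : Bond d (towerP L m (n + 1)) => (1 : 𝔸ˣ)) (covDivL2K ℂ c₀ ((η : ℂ))⁻¹ (adTransportW φ fun _ : Bond d (towerP L m (n + 1)) => (1 : 𝔸ˣ)⁻¹) w))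
    have h4 : (sS * α) * ‖w‖ ≤ (sS * α) * N w := mul_le_mul_of_nonneg_left (hNn w) hsSα
    have h5 : CR * α * ‖covDivL2K ℂ c₀ ((η : ℂ))⁻¹ (adTransportW φ fun _ : Bond d (towerP L m (n + 1)) => (1 : 𝔸ˣ)⁻¹) w‖ ≤ CR * α * N w := mul_le_mul_of_nonneg_left (hNd w) hCRα
    have h6 : (sS * α) * N w + CR * α * N w = (sP * α) * N w := by rw [hsPdef]; ring
    exact h3.trans ((add_le_add (h1.trans h4) (h2.trans h5)).trans h6.le)
  have hP₀ : ∀ w : BondL2K ℂ d (towerP L m (n + 1)) c₀ W, ‖RofUk L m n φ η (fun _ : Bond d (towerP L m (n + 1)) => (1 : 𝔸ˣ)) (covDivL2K ℂ c₀ ((η : ℂ))⁻¹ (adTransportW φ fun _ : Bond d (towerP L m (n + 1)) => (1 : 𝔸ˣ)⁻¹) w)‖ ≤ 1 * N w :=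
    fun w => (hR1le _).trans (by rw [one_mul]; exact hNd w)
  -- δ_Q, M_Q: the averaging letters
  have hQ1b : ∀ w : BondL2K ℂ d (towerP L m (n + 1)) c₀ W, ‖(QkW L m n φ (fun _ : Bond d (towerP L m (n + 1)) => (1 : 𝔸ˣ)) hL (fun _ => 0) (fun _ => by norm_num)
        (perCfg_UlevOf_one_mem_U1 L m (n + 1)) (norm_Wcx_UlevOf_one_sub_one_le L m (n + 1) (fun _ => 0) (fun _ => le_rfl)) (c₀ := c₀) (c₁ := c₁)) w‖ ≤ Mφ' * Mφ * ‖w‖ := fun w => by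
    have h := norm_QkW_one_le_canonical L m n hL φ hMφ hφ hMφ' hφ' (fun _ => 0) (fun _ => by norm_num)
      (perCfg_UlevOf_one_mem_U1 L m (n + 1)) (norm_Wcx_UlevOf_one_sub_one_le L m (n + 1) (fun _ => 0) (fun _ => le_rfl)) (c₀ := c₀)
      (c₁ := c₁) hηL0 hs w
    rw [hηL, inv_one, mul_one] at h
    exact h
  have hQd : ∀ w : BondL2K ℂ d (towerP L m (n + 1)) c₀ W, ‖(QkW L m n φ U hL αU hα1 hU1 hreg (c₀ := c₀) (c₁ := c₁)) w - (QkW L m n φ (fun _ : Bond d (towerP L m (n + 1)) => (1 : 𝔸ˣ)) hL (fun _ => 0) (fun _ => by norm_num)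
        (perCfg_UlevOf_one_mem_U1 L m (n + 1)) (norm_Wcx_UlevOf_one_sub_one_le L m (n + 1) (fun _ => 0) (fun _ => le_rfl)) (c₀ := c₀) (c₁ := c₁)) w‖ ≤ (CQ * α) * ‖w‖ := fun w => by
    have h := norm_QkW_sub_flat_le_L2_geometric L m n hL φ hMφ hMφ' hφ hφ' (c₀ := c₀) (c₁ := c₁) U αU hα1 hU1 hreg εU hεU hUε hr0 hr1 hα0
      hεg w
    rw [sqrt_ratio_diagonal hc₁ hw, mul_one, ← hΞdef] at h
    exact h.trans (mul_le_mul_of_nonneg_right heM (norm_nonneg _))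
  have hQUb : ∀ w : BondL2K ℂ d (towerP L m (n + 1)) c₀ W, ‖(QkW L m n φ U hL αU hα1 hU1 hreg (c₀ := c₀) (c₁ := c₁)) w‖ ≤ MQ0 * ‖w‖ := fun w => by
    have h1 : ‖(QkW L m n φ U hL αU hα1 hU1 hreg (c₀ := c₀) (c₁ := c₁)) w‖ ≤ ‖(QkW L m n φ (fun _ : Bond d (towerP L m (n + 1)) => (1 : 𝔸ˣ)) hL (fun _ => 0) (fun _ => by norm_num)
        (perCfg_UlevOf_one_mem_U1 L m (n + 1)) (norm_Wcx_UlevOf_one_sub_one_le L m (n + 1) (fun _ => 0) (fun _ => le_rfl)) (c₀ := c₀) (c₁ := c₁)) w‖ + ‖(QkW L m n φ U hL αU hα1 hU1 hreg (c₀ := c₀) (c₁ := c₁)) w - (QkW L m n φ (fun _ : Bond d (towerP L m (n + 1)) => (1 : 𝔸ˣ)) hL (fun _ => 0) (fun _ => by norm_num)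
        (perCfg_UlevOf_one_mem_U1 L m (n + 1)) (norm_Wcx_UlevOf_one_sub_one_le L m (n + 1) (fun _ => 0) (fun _ => le_rfl)) (c₀ := c₀) (c₁ := c₁)) w‖ := by
      have h := norm_add_le ((QkW L m n φ (fun _ : Bond d (towerP L m (n + 1)) => (1 : 𝔸ˣ)) hL (fun _ => 0) (fun _ => by norm_num)
        (perCfg_UlevOf_one_mem_U1 L m (n + 1)) (norm_Wcx_UlevOf_one_sub_one_le L m (n + 1) (fun _ => 0) (fun _ => le_rfl)) (c₀ := c₀) (c₁ := c₁)) w) ((QkW L m n φ U hL αU hα1 hU1 hreg (c₀ := c₀) (c₁ := c₁)) w - (QkW L m n φ (fun _ : Bond d (towerP L m (n + 1)) => (1 : 𝔸ˣ)) hL (fun _ => 0) (fun _ => by norm_num)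
        (perCfg_UlevOf_one_mem_U1 L m (n + 1)) (norm_Wcx_UlevOf_one_sub_one_le L m (n + 1) (fun _ => 0) (fun _ => le_rfl)) (c₀ := c₀) (c₁ := c₁)) w)
      rwa [add_sub_cancel] at h
    have h2 : ‖(QkW L m n φ (fun _ : Bond d (towerP L m (n + 1)) => (1 : 𝔸ˣ)) hL (fun _ => 0) (fun _ => by norm_num)
        (perCfg_UlevOf_one_mem_U1 L m (n + 1)) (norm_Wcx_UlevOf_one_sub_one_le L m (n + 1) (fun _ => 0) (fun _ => le_rfl)) (c₀ := c₀) (c₁ := c₁)) w‖ + ‖(QkW L m n φ U hL αU hα1 hU1 hreg (c₀ := c₀) (c₁ := c₁)) w - (QkW L m n φ (fun _ : Bond d (towerP L m (n + 1)) => (1 : 𝔸ˣ)) hL (fun _ => 0) (fun _ => by norm_num)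
        (perCfg_UlevOf_one_mem_U1 L m (n + 1)) (norm_Wcx_UlevOf_one_sub_one_le L m (n + 1) (fun _ => 0) (fun _ => le_rfl)) (c₀ := c₀) (c₁ := c₁)) w‖ ≤ (Mφ' * Mφ + CQ * α) * ‖w‖ := by
      rw [add_mul]; exact add_le_add (hQ1b w) (hQd w)
    exact h1.trans (h2.trans (mul_le_mul_of_nonneg_right hMQα (norm_nonneg _)))
  have hQ1b' : ∀ w : BondL2K ℂ d (towerP L m (n + 1)) c₀ W, ‖(QkW L m n φ (fun _ : Bond d (towerP L m (n + 1)) => (1 : 𝔸ˣ)) hL (fun _ => 0) (fun _ => by norm_num)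
        (perCfg_UlevOf_one_mem_U1 L m (n + 1)) (norm_Wcx_UlevOf_one_sub_one_le L m (n + 1) (fun _ => 0) (fun _ => le_rfl)) (c₀ := c₀) (c₁ := c₁)) w‖ ≤ MQ0 * ‖w‖ := fun w =>
    (hQ1b w).trans (mul_le_mul_of_nonneg_right ((le_add_of_nonneg_right hCQα).trans hMQα) (norm_nonneg _))
  -- the structure letters
  have hadjU : ∀ (y : BondL2K ℂ d (towerP L m (n + 1)) c₀ W) (z : BondL2K ℂ d m c₁ W), ⟪(QkW L m n φ U hL αU hα1 hU1 hreg (c₀ := c₀) (c₁ := c₁)) y, z⟫_ℂ = ⟪y, LinearMap.adjoint (QkW L m n φ U hL αU hα1 hU1 hreg (c₀ := c₀) (c₁ := c₁)) z⟫_ℂ :=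
    fun y z => (LinearMap.adjoint_inner_right _ y z).symm
  have hadj1 : ∀ (y : BondL2K ℂ d (towerP L m (n + 1)) c₀ W) (z : BondL2K ℂ d m c₁ W), ⟪(QkW L m n φ (fun _ : Bond d (towerP L m (n + 1)) => (1 : 𝔸ˣ)) hL (fun _ => 0) (fun _ => by norm_num)
        (perCfg_UlevOf_one_mem_U1 L m (n + 1)) (norm_Wcx_UlevOf_one_sub_one_le L m (n + 1) (fun _ => 0) (fun _ => le_rfl)) (c₀ := c₀) (c₁ := c₁)) y, z⟫_ℂ = ⟪y, LinearMap.adjoint (QkW L m n φ (fun _ : Bond d (towerP L m (n + 1)) => (1 : 𝔸ˣ)) hL (fun _ => 0) (fun _ => by norm_num)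
        (perCfg_UlevOf_one_mem_U1 L m (n + 1)) (norm_Wcx_UlevOf_one_sub_one_le L m (n + 1) (fun _ => 0) (fun _ => le_rfl)) (c₀ := c₀) (c₁ := c₁)) z⟫_ℂ :=
    fun y z => (LinearMap.adjoint_inner_right _ y z).symm
  have hinjU := adjoint_injective_of_surjective _ hQU
  have hinj1 := adjoint_injective_of_surjective _ hQ1
  have hDDU : ∀ (s : SiteL2K ℂ d (towerP L m (n + 1)) c₀ W) (y : BondL2K ℂ d (towerP L m (n + 1)) c₀ W), ⟪covDerivL2K ℂ c₀ ((η : ℂ))⁻¹ (adTransportW φ U) s, y⟫_ℂ = ⟪s, covDivL2K ℂ c₀ ((η : ℂ))⁻¹ (adTransportW φ fun b => (U b)⁻¹) y⟫_ℂ := by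
    intro s y; rw [← adjoint_covDerivL2K ((η : ℂ))⁻¹ hc _ _ hRS, LinearMap.adjoint_inner_right]
  have hDD1 : ∀ (s : SiteL2K ℂ d (towerP L m (n + 1)) c₀ W) (y : BondL2K ℂ d (towerP L m (n + 1)) c₀ W), ⟪covDerivL2K ℂ c₀ ((η : ℂ))⁻¹ (adTransportW φ (fun _ : Bond d (towerP L m (n + 1)) => (1 : 𝔸ˣ))) s, y⟫_ℂ = ⟪s, covDivL2K ℂ c₀ ((η : ℂ))⁻¹ (adTransportW φ fun _ : Bond d (towerP L m (n + 1)) => (1 : 𝔸ˣ)⁻¹) y⟫_ℂ := by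
    intro s y; rw [← adjoint_covDerivL2K ((η : ℂ))⁻¹ hc _ _ (hRS_one φ), LinearMap.adjoint_inner_right]
  have hRsymU : ∀ s t : SiteL2K ℂ d (towerP L m (n + 1)) c₀ W, ⟪RofUk L m n φ η U s, t⟫_ℂ = ⟪s, RofUk L m n φ η U t⟫_ℂ := fun s t => RofUk_isSymmetric L m n φ η U s t
  have hRsym1 : ∀ s t : SiteL2K ℂ d (towerP L m (n + 1)) c₀ W, ⟪RofUk L m n φ η (fun _ : Bond d (towerP L m (n + 1)) => (1 : 𝔸ˣ)) s, t⟫_ℂ = ⟪s, RofUk L m n φ η (fun _ : Bond d (towerP L m (n + 1)) => (1 : 𝔸ˣ)) t⟫_ℂ := fun s t => RofUk_isSymmetric L m n φ η _ s t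
  have hRRU : ∀ s : SiteL2K ℂ d (towerP L m (n + 1)) c₀ W, RofUk L m n φ η U (RofUk L m n φ η U s) = RofUk L m n φ η U s :=
    fun s => by unfold RofUk B11Eq103H1Complex.RLatticeK; exact projR_projR _ _ s
  have hRR1 : ∀ s : SiteL2K ℂ d (towerP L m (n + 1)) c₀ W, RofUk L m n φ η (fun _ : Bond d (towerP L m (n + 1)) => (1 : 𝔸ˣ)) (RofUk L m n φ η (fun _ : Bond d (towerP L m (n + 1)) => (1 : 𝔸ˣ)) s) = RofUk L m n φ η (fun _ : Bond d (towerP L m (n + 1)) => (1 : 𝔸ˣ)) s :=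
    fun s => by unfold RofUk B11Eq103H1Complex.RLatticeK; exact projR_projR _ _ s
  -- `B9Eq3153FrakGLipschitzEnergy.norm_apply_frakG_sub_le` (structure 1 := `U`, structure 0 := flat)
  refine ⟨?_, ?_, ?_⟩
  · refine le_trans ?_ hCb1
    rw [← hCfin]
    have h := norm_apply_frakG_sub_le (𝕜 := ℂ) hpos1 hadj1 hinj1 hposU hadjU hinjU N hN0 hNn hγ₁ hγ₁ hΘα hCQα hCK1 hCKU hMQ0 hsPα zero_le_one
      (by norm_num : (0 : ℝ) ≤ 2) (by norm_num : (0 : ℝ) ≤ 2) hsSα hCRα zero_le_one hcoerU hcoer1 hT hQd hK1 hKU hQUb hQ1b' hP hP₀ hRDU hRD1 hDD1 hDDU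
      hRsym1 hRsymU hRR1 hRRU hNd hDd hR hRone (LinearMap.id : BondL2K ℂ d (towerP L m (n + 1)) c₀ W →ₗ[ℂ] BondL2K ℂ d (towerP L m (n + 1)) c₀ W) hNid x
    rw [LinearMap.id_apply] at h
    exact h
  · refine le_trans ?_ hCb1
    rw [← hCfin]
    exact norm_apply_frakG_sub_le (𝕜 := ℂ) hpos1 hadj1 hinj1 hposU hadjU hinjU N hN0 hNn hγ₁ hγ₁ hΘα hCQα hCK1 hCKU hMQ0 hsPα zero_le_one
      (by norm_num : (0 : ℝ) ≤ 2) (by norm_num : (0 : ℝ) ≤ 2) hsSα hCRα zero_le_one hcoerU hcoer1 hT hQd hK1 hKU hQUb hQ1b' hP hP₀ hRDU hRD1 hDD1 hDDU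
      hRsym1 hRsymU hRR1 hRRU hNd hDd hR hRone (covCurlL2K ℂ c₀ ((η : ℂ))⁻¹ (adTransportW φ (fun _ : Bond d (towerP L m (n + 1)) => (1 : 𝔸ˣ)))) hNc x
  · refine le_trans ?_ hCb1
    rw [← hCfin]
    exact norm_apply_frakG_sub_le (𝕜 := ℂ) hpos1 hadj1 hinj1 hposU hadjU hinjU N hN0 hNn hγ₁ hγ₁ hΘα hCQα hCK1 hCKU hMQ0 hsPα zero_le_one
      (by norm_num : (0 : ℝ) ≤ 2) (by norm_num : (0 : ℝ) ≤ 2) hsSα hCRα zero_le_one hcoerU hcoer1 hT hQd hK1 hKU hQUb hQ1b' hP hP₀ hRDU hRD1 hDD1 hDDU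
      hRsym1 hRsymU hRR1 hRRU hNd hDd hR hRone (covDivL2K ℂ c₀ ((η : ℂ))⁻¹ (adTransportW φ fun _ : Bond d (towerP L m (n + 1)) => (1 : 𝔸ˣ)⁻¹)) hNd x

end Literature.MathematicalPhysics.QuantumFieldTheory.Balaban1983to89.B9Eq3153FrakGkLipschitzEnergyDiagonal

end
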